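import Summits.AtomisticToContinuum.HydrodynamicLimit.Theses.AntiMazurCoboundaries
import Literature.Analysis.FluidPDE.HardSphereAlexander
import Literature.MathematicalPhysics.KineticTheory.HardSphereEulerProofs

/-!
# `KineticFluxLdDecay` without the orthogonality clause is FALSE

Negative knowledge for the crux `AntiMazurCoboundaries.KineticFluxLdDecay` (stmt-AtomisticToContinuum-10967,
shared with `FluxGibbsianityLdDrude`), from the standing disprover's
`Cruxes/KineticFluxLdDecay/Disproof.lean` § 2. `KineticFluxLdDecayWithoutOrthogonality` is the crux VERBATIM
with the hypothesis `g ⊥ span{1, v, |v|²}` deleted (so it implies the crux; recorded contrapositively as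
`KineticFluxLdDecayWithoutOrthogonality.not_of_not_crux`), and it is false UNCONDITIONALLY: for `φ ≡ 1`, `g ≡ κ`
the window average is identically `(N+1) κ` whatever the flow, so the LD functional is exactly
`e^{κ(N+1)} > e^{(κ/2)(N+1)}`; a flow to test through exists by Alexander's theorem on `𝕋³`
(`HardSphereFlow.nonempty_torus_holds`, PROVED in the tree), so no hypothesis is left over.
Moral for provers: any proof must use the orthogonality clause already at the level of the mean
(`⊥ 1`); the finer necessity of `⊥ v`, `⊥ |v|²` and of the amplitude clause (Gibbs drift /
temperature tilts) is recorded in the Disproof file. refuter-cdisprove-stmt-AtomisticToContinuum-10967-0.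
-/

noncomputable section

namespace Summit.AtomisticToContinuum.HydrodynamicLimit.Theorems

open MeasureTheory
open scoped ENNReal
open Literature.MathematicalPhysics.KineticTheory Literature.Analysis.FluidPDE
open Summit.AtomisticToContinuum.HydrodynamicLimit.Theses.AntiMazurCoboundaries (KineticFluxLdDecay)

/-- The crux `KineticFluxLdDecay` with the orthogonality hypothesis
`∀ c₀ c₂ b, ∫ g v * (c₀ + ⟪b, v⟫ + c₂ ‖v‖²) d stdGaussian = 0` DELETED (all else verbatim). -/
def KineticFluxLdDecayWithoutOrthogonality : Prop :=
  ∀ (a θ : ℝ) (u₀ : V3), 0 < a → 0 < θ → ∃ σ₀ : ℝ, 0 < σ₀ ∧ ∀ σ : ℝ, 0 < σ → σ < σ₀ →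
    (∀ (N : ℕ) (Φ : HardSphereFlow (Torus.geometry (Fin 3)) (hsDiameter σ N) (N + 1)),
      IsProbabilityMeasure (localGibbsLaw σ (fun _ => a) (fun _ => u₀) (fun _ => θ) N Φ)) ∧
    ∃ κ : ℝ, 0 < κ ∧ ∀ (φ : T3 → ℝ) (g : V3 → ℝ), Continuous φ → Continuous g →
      (∀ x, |φ x| ≤ 1) → (∀ v, |g v| ≤ κ) → ∀ δ : ℝ, 0 < δ → ∃ τ : ℝ, 0 < τ ∧ ∃ N₀ : ℕ,
        ∀ N : ℕ, N₀ ≤ N →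
        ∀ Φ : HardSphereFlow (Torus.geometry (Fin 3)) (hsDiameter σ N) (N + 1),
          ∫⁻ z, ENNReal.ofReal (Real.exp ((τ * ((N + 1 : ℕ) : ℝ) ^ (-(1 / 3 : ℝ)))⁻¹ *
            ∫ s in (0 : ℝ)..(τ * ((N + 1 : ℕ) : ℝ) ^ (-(1 / 3 : ℝ))),
              ∑ i, φ (Φ.flow s z i).1 * g ((Real.sqrt θ)⁻¹ • ((Φ.flow s z i).2 - u₀))))
            ∂(localGibbsLaw σ (fun _ => a) (fun _ => u₀) (fun _ => θ) N Φ) ≤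
          ENNReal.ofReal (Real.exp (δ * (N + 1)))

namespace KineticFluxLdDecayWithoutOrthogonality

/-- Sanity (contrapositive form, so that no Theses decl is concluded positively): the variant is the crux
minus exactly the orthogonality clause — a refutation of the crux would refute the variant. [folklore] -/
theorem not_of_not_crux : ¬ KineticFluxLdDecay → ¬ KineticFluxLdDecayWithoutOrthogonality := by
  intro hn h
  refine hn fun a θ u₀ ha hθ => ?_
  obtain ⟨σ₀, hσ₀, H⟩ := h a θ u₀ ha hθ
  refine ⟨σ₀, hσ₀, fun σ hσ hσ' => ?_⟩
  obtain ⟨hA, κ, hκ, hB⟩ := H σ hσ hσ'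
  exact ⟨hA, κ, hκ, fun φ g hφ hg hφ1 hgκ _ => hB φ g hφ hg hφ1 hgκ⟩

/-- Flows to test through exist: Alexander's theorem on `𝕋³` for diameter `σ(N+1)^{-1/3} ≤ σ < 1/2`. [folklore] -/
theorem flow_nonempty {σ : ℝ} (hσ : 0 < σ) (hσ' : σ < 2⁻¹) (N : ℕ) :
    Nonempty (HardSphereFlow (Torus.geometry (Fin 3)) (hsDiameter σ N) (N + 1)) :=
  HardSphereFlow.nonempty_torus_holds (d := Fin 3) (hsDiameter_pos hσ N)
    ((hsDiameter_le hσ.le N).trans_lt hσ') (N + 1)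

/-- For the CONSTANT observable `φ ≡ 1`, `g ≡ c` the window average is identically `(N+1) c` and the
LD functional under a probability law is exactly `e^{(N+1)c}`, whatever the flow and the window. [folklore] -/
theorem lintegral_exp_window_const {σ a θ : ℝ} {u₀ : V3} (c : ℝ) {h : ℝ} (hh : h ≠ 0) {N : ℕ}
    (Φ : HardSphereFlow (Torus.geometry (Fin 3)) (hsDiameter σ N) (N + 1))
    [IsProbabilityMeasure (localGibbsLaw σ (fun _ => a) (fun _ => u₀) (fun _ => θ) N Φ)] :
    ∫⁻ z, ENNReal.ofReal (Real.exp (h⁻¹ * ∫ s in (0 : ℝ)..h,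
        ∑ i, (fun _ : T3 => (1 : ℝ)) (Φ.flow s z i).1 *
          (fun _ : V3 => c) ((Real.sqrt θ)⁻¹ • ((Φ.flow s z i).2 - u₀))))
      ∂(localGibbsLaw σ (fun _ => a) (fun _ => u₀) (fun _ => θ) N Φ) =
    ENNReal.ofReal (Real.exp (((N + 1 : ℕ) : ℝ) * c)) := by
  simp only [one_mul, Finset.sum_const, Finset.card_univ, Fintype.card_fin, nsmul_eq_mul,
    intervalIntegral.integral_const, sub_zero, smul_eq_mul, ← mul_assoc, inv_mul_cancel₀ hh,
    lintegral_const, measure_univ, mul_one]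

end KineticFluxLdDecayWithoutOrthogonality

open KineticFluxLdDecayWithoutOrthogonality in
/-- **The orthogonality clause of `KineticFluxLdDecay` is load-bearing**: with it deleted the statement is
false (witness `a = θ = 1`, `u₀ = 0`, `σ = min(σ₀/2, 1/4)`, `φ ≡ 1`, `g ≡ κ`, `δ = κ/2`, `N = N₀`, Alexander's
flow: the functional is `e^{κ(N+1)} > e^{(κ/2)(N+1)}`). [folklore] -/
theorem kineticFluxLdDecay_false_without_orthogonality : ¬ KineticFluxLdDecayWithoutOrthogonality := by
  intro h
  obtain ⟨σ₀, hσ₀, H⟩ := h 1 1 0 one_pos one_pos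
  set σ : ℝ := min (σ₀ / 2) 4⁻¹
  have hσpos : 0 < σ := lt_min (by positivity) (by norm_num)
  have hσlt : σ < σ₀ := (min_le_left _ _).trans_lt (by linarith)
  have hσhalf : σ < 2⁻¹ := (min_le_right _ _).trans_lt (by norm_num)
  obtain ⟨hA, κ, hκ, hB⟩ := H σ hσpos hσlt
  obtain ⟨τ, hτ, N₀, hN⟩ := hB (fun _ => 1) (fun _ => κ) continuous_const continuous_const
    (fun _ => by simp) (fun _ => by simp [abs_of_pos hκ]) (κ / 2) (by positivity)
  obtain ⟨Φ⟩ := flow_nonempty hσpos hσhalf N₀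
  haveI := hA N₀ Φ
  have hh : τ * ((N₀ + 1 : ℕ) : ℝ) ^ (-(1 / 3 : ℝ)) ≠ 0 :=
    (mul_pos hτ (Real.rpow_pos_of_pos (by positivity) _)).ne'
  have key := hN N₀ le_rfl Φ
  rw [lintegral_exp_window_const κ hh Φ, ENNReal.ofReal_le_ofReal_iff (Real.exp_pos _).le,
    Real.exp_le_exp] at key
  have hpos : (0 : ℝ) < ((N₀ + 1 : ℕ) : ℝ) := by positivity
  push_cast at key hpos
  nlinarith

end Summit.AtomisticToContinuum.HydrodynamicLimit.Theorems
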